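import Summits.CriticalPhenomena.PercolationContinuityZ3.Theorems.PercNearOneGluingNoHeavyLowerTailSahiSunflowerAllOrdersThreePointInc
import Summits.CriticalPhenomena.PercolationContinuityZ3.Theorems.PercNearOneGluingNoHeavyLowerTailTIncSwitching
import HarnessLib

/-!
# `NoHeavyLowerTail` (crux stmt-CriticalPhenomena-4575), master family: the INCREASING 3-point pattern algebra is
# Sahi-positive of EVERY order on EVERY finite weighted graph — unconditional (the 3-point Sahi tower, increasing side)

Support file (injection-mining analyst `prim-injmine-2`, staged for a prover seat; `--supports stmt-CriticalPhenomena-4575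
--as helper`); no named fact, no sorry.  Pure assembly of two tree theorems:
* `SahiDeltaSystem.sahiPositive_pat3inc_iff` (prim-masterthm-p2): for every finite weighted graph and `a b c`, the
  increasing 3-point pattern weight on `M₃` is Sahi-positive of every order iff `T_inc ≥ 0`;
* `TIncSwitching.sahiE3_nonIsol_nonneg` (prim-e3grp-switch-1, three-copy reveal-only switching certificate `I5`):
  `T_inc = E₃({a↔b}∪{a↔c}, {a↔b}∪{b↔c}, {a↔c}∪{b↔c}) ≥ 0` on every finite weighted graph.
Hence (`sahiPositive_pat3inc`, `sahiE_threePointPatternInc_nonneg`): for every `n` and all nonnegative functions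
`f_i : M₃ → ℝ` increasing from `core` (nothing joined) to `out` (all joined), `E_n(f₀ ∘ pat3inc, …, f_{n−1} ∘ pat3inc) ≥ 0`
under the percolation weight — every multiset row of the increasing 3-point connectivity events (`{x↔y}`, `N_x`,
`{a↔b↔c}`, unions) at every order.  Together with `…SahiSunflowerAllOrdersThreePoint` (decreasing side, from `3PT-LB`) this
is Sahi's conjecture `C_n` for all `n` on both same-direction 3-point connectivity algebras of Bernoulli bond percolation
(memo run/shared/lean/prim/prim-injmine/prim-injmine-2/UNIFORM-K.md §2: on three marked points the nested-pair peel leaves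
exactly the two cubic generators `3PT-LB` and `T_inc`).
-/

noncomputable section

namespace Summit.CriticalPhenomena.PercolationContinuityZ3.Theorems.SahiDeltaSystem

open Finset Function MeasureTheory Literature.Combinatorics.Sahi2008
open Literature.Probability.LatticeModels (prodBernoulli sahiE3)
open Literature.Probability.Percolation
open M3

variable {V : Type*} [Fintype V]

/-- **The increasing 3-point pattern weight is Sahi-positive of every order, on every finite weighted graph.** [this work] -/
theorem sahiPositive_pat3inc (w : Sym2 V → unitInterval) (a b c : V) (n : ℕ) :
    SahiPositive (pushWeight (bernoulliWeight w) (pat3inc a b c)) n := by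
  classical
  exact (sahiPositive_pat3inc_iff w a b c).2 (TIncSwitching.sahiE3_nonIsol_nonneg w a b c) n

/-- **Every `E_n` of increasing 3-point pattern functions is nonnegative, unconditionally.**  For all `n` and all
nonnegative `f_i : M₃ → ℝ` increasing from `core` to `out`: `E_n(f₀ ∘ pat3inc, …, f_{n−1} ∘ pat3inc) ≥ 0` under the
percolation weight of any finite weighted graph. [this work] -/
theorem sahiE_threePointPatternInc_nonneg (w : Sym2 V → unitInterval) (a b c : V)
    {n : ℕ} (f : Fin n → M3 → ℝ) (hf0 : ∀ i x, 0 ≤ f i x) (hmono : ∀ i, Monotone (f i)) :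
    0 ≤ sahiE (bernoulliWeight w) n fun i => f i ∘ pat3inc a b c := by
  rw [← sahiE_pushWeight]
  exact sahiPositive_pat3inc w a b c n f hf0 hmono

end Summit.CriticalPhenomena.PercolationContinuityZ3.Theorems.SahiDeltaSystem
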